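import Summits.ValiantsHypothesis.ValiantsHypothesis.Theorems.KPlusLogSqLawValuativeDoorNestedPairs
import Summits.ValiantsHypothesis.ValiantsHypothesis.Theorems.KPlusLogSqLawValuativeDoorGenTwoGram

/-!
# LINE `valuative_door` (crux `WeakLifting`, stmt-ValiantsHypothesis-19561) — general `2 × 2` Sidon pencils when `v 2 = 1`
# (residue characteristic ≠ 2): a dominant DIAGONAL exponent inside two nested dominant pairs is impossible, and the
# two-obstruction count `#pairs + #diagonals ≤ (2K − 1) + (2K − 5)`

HONEST FRAMING.  Helper (cell `pub-symmetroid`, seat val-sym-lift-p1 g23, 2026-08-29; `--supports 19561 --as helper`).  Toward the sharper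
general-letter row `npEdges ≤ 4K − 7` under the extra hypothesis `v 2 = 1` (sequel `…GenTwoUnitTwoLaw`; the all-field row is `5K − 11`,
`…GenTwoSidon`).  (1) `not_nestedDiag_dominant_gen_of_sidon`: for five letters `d i₀ < … < d i₄` of a general `2 × 2` Sidon pencil and
`v 2 = 1`, the exponents `d i₀ + d i₄`, `d i₁ + d i₃`, `2 d i₂` are never all dominant — the PRINCIPAL `5 × 5` Gram minor of the rank-four
polarised determinant, whose reversal term passes through the diagonal entry `β(M, M) = 2 det M` (hence `v 2 = 1`; residue characteristic
`2` is NOT covered); roof of three dominance lines + the weak two-slope rearrangement of `…NestedPairs`.  (2) `card_pairs_add_diag_le`: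
a family `P` of pairs `i < j` with no three pairwise nested members and a set `Q` of letters none of which lies strictly inside the inner
pair of two nested members of `P` satisfy `#P + #Q ≤ (2K − 1) + (2K − 5)` (two-copy injection by `i + j` / `2b`; located-sharp: the
extremal value `4K − 6` for `K = 3..7` by brute force and `= ` the tropical maximum found for general letters at `K = 5, 6`).  Calibration
only; no bearing on vW / vB, `TropicalB`, `MatrixDescartes` (18050) or VP ≠ VNP.  [elementary]
-/

set_option linter.dupNamespace false
set_option autoImplicit false

namespace Summit.ValiantsHypothesis.ValiantsHypothesis.Theorems.KPlusLogSqLaw.ValDoor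

open Polynomial Finset Matrix
open scoped BigOperators Classical

variable {F : Type*} [Field F]

/-! ## §1 A dominant diagonal inside two nested dominant pairs is impossible when `v 2 = 1` -/

/-- **NESTED–DIAGONAL EXCLUSION (general letters, `v 2 = 1`).**  For a `2 × 2` lacunary pencil on a Sidon support and five letters with
`d i₀ < d i₁ < d i₂ < d i₃ < d i₄`, the exponents `d i₀ + d i₄`, `d i₁ + d i₃` and `d i₂ + d i₂` are not all dominant when `v 2 = 1`.
[principal rank-four Gram minor; the reversal passes through `β(M_{i₂}, M_{i₂}) = 2 det M_{i₂}`] -/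
theorem not_nestedDiag_dominant_gen_of_sidon (v : AbsoluteValue F ℝ) (hv : IsNonarchimedean v) (hv2 : v 2 = 1) {K : ℕ}
    (d : Fin K → ℕ) (M : Fin K → Matrix (Fin 2) (Fin 2) F)
    (hsid : ∀ l₁ l₂ l₃ l₄ : Fin K, d l₁ + d l₂ = d l₃ + d l₄ → (l₁ = l₃ ∧ l₂ = l₄) ∨ (l₁ = l₄ ∧ l₂ = l₃))
    {i₀ i₁ i₂ i₃ i₄ : Fin K} (h01 : d i₀ < d i₁) (h12 : d i₁ < d i₂) (h23 : d i₂ < d i₃) (h34 : d i₃ < d i₄)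
    (hdom : ∀ E ∈ ({d i₀ + d i₄, d i₁ + d i₃, d i₂ + d i₂} : Finset ℕ),
      E ∈ (Matrix.det (∑ l, ((X : F[X]) ^ d l) • (M l).map (C : F →+* F[X]))).support ∧
      ∃ r : ℝ, 0 < r ∧ ∀ E' ∈ (Matrix.det (∑ l, ((X : F[X]) ^ d l) • (M l).map (C : F →+* F[X]))).support, E' ≠ E →
        v ((Matrix.det (∑ l, ((X : F[X]) ^ d l) • (M l).map (C : F →+* F[X]))).coeff E') * r ^ E'
          < v ((Matrix.det (∑ l, ((X : F[X]) ^ d l) • (M l).map (C : F →+* F[X]))).coeff E) * r ^ E) :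
    False := by
  set f : F[X] := Matrix.det (∑ l, ((X : F[X]) ^ d l) • (M l).map (C : F →+* F[X])) with hf
  set e : Fin 5 → Fin K := ![i₀, i₁, i₂, i₃, i₄] with he
  have he0 : e 0 = i₀ := rfl
  have he1 : e 1 = i₁ := rfl
  have he2 : e 2 = i₂ := rfl
  have he3 : e 3 = i₃ := rfl
  have he4 : e 4 = i₄ := rfl
  have hmono : StrictMono (d ∘ e) := by
    refine Fin.strictMono_iff_lt_succ.2 fun i => ?_
    fin_cases i
    · exact h01
    · exact h12
    · exact h23
    · exact h34
  have heinj : Function.Injective e := fun i j hij => hmono.injective (by simp only [Function.comp_apply, hij])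
  set B₀ : ℕ := d i₀ + d i₄ with hB₀
  set B₁ : ℕ := d i₁ + d i₃ with hB₁
  set B₂ : ℕ := d i₂ + d i₂ with hB₂
  have hd0 := hdom B₀ (by simp [hB₀])
  have hd1 := hdom B₁ (by simp [hB₁])
  have hd2 := hdom B₂ (by simp [hB₂])
  -- Sidon bookkeeping
  have hsum_rev : ∀ r c : Fin 5, (d (e r) + d (e c) = B₀ ∨ d (e r) + d (e c) = B₁ ∨ d (e r) + d (e c) = B₂) → r = Fin.revPerm c := by
    intro r c h
    have key : ∀ u w : Fin 5, d (e r) + d (e c) = d (e u) + d (e w) →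
        (r.val = u.val ∧ c.val = w.val) ∨ (r.val = w.val ∧ c.val = u.val) := by
      intro u w huw
      rcases hsid _ _ _ _ huw with ⟨h1, h2⟩ | ⟨h1, h2⟩
      · exact Or.inl ⟨congrArg Fin.val (heinj h1), congrArg Fin.val (heinj h2)⟩
      · exact Or.inr ⟨congrArg Fin.val (heinj h1), congrArg Fin.val (heinj h2)⟩
    apply Fin.ext
    rw [Fin.revPerm_apply, Fin.val_rev]
    have hr := r.isLt
    have hc := c.isLt
    rcases h with h | h | h
    · rw [hB₀, ← he0, ← he4] at h
      rcases key 0 4 h with ⟨h1, h2⟩ | ⟨h1, h2⟩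
      · simp at h1 h2; omega
      · simp at h1 h2; omega
    · rw [hB₁, ← he1, ← he3] at h
      rcases key 1 3 h with ⟨h1, h2⟩ | ⟨h1, h2⟩
      · simp at h1 h2; omega
      · simp at h1 h2; omega
    · rw [hB₂, ← he2] at h
      rcases key 2 2 h with ⟨h1, h2⟩ | ⟨h1, h2⟩
      · simp at h1 h2; omega
      · simp at h1 h2; omega
  have hrevB : ∀ c : Fin 5, d (e (Fin.revPerm c)) + d (e c) = B₀ ∨ d (e (Fin.revPerm c)) + d (e c) = B₁ ∨
      d (e (Fin.revPerm c)) + d (e c) = B₂ := by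
    intro c
    fin_cases c
    · left; show d (e (Fin.rev 0)) + d (e 0) = B₀
      rw [show Fin.rev (0 : Fin 5) = 4 from rfl, he4, he0, hB₀, Nat.add_comm]
    · right; left; show d (e (Fin.rev 1)) + d (e 1) = B₁
      rw [show Fin.rev (1 : Fin 5) = 3 from rfl, he3, he1, hB₁, Nat.add_comm]
    · right; right; show d (e (Fin.rev 2)) + d (e 2) = B₂
      rw [show Fin.rev (2 : Fin 5) = 2 from rfl, he2]
    · right; left; show d (e (Fin.rev 3)) + d (e 3) = B₁
      rw [show Fin.rev (3 : Fin 5) = 1 from rfl, he1, he3]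
    · left; show d (e (Fin.rev 4)) + d (e 4) = B₀
      rw [show Fin.rev (4 : Fin 5) = 0 from rfl, he0, he4]
  -- the three dominance lines and their roof
  set ℓ : ℕ → ℝ := fun E => Real.log (v (f.coeff E)) with hℓ
  obtain ⟨s₀, hs₀⟩ := (exists_dominant_iff_exists_slope v f hd0.1).1 hd0.2
  obtain ⟨s₁, hs₁⟩ := (exists_dominant_iff_exists_slope v f hd1.1).1 hd1.2
  obtain ⟨s₂, hs₂⟩ := (exists_dominant_iff_exists_slope v f hd2.1).1 hd2.2
  set h : ℝ → ℝ := fun t => min (min (ℓ B₀ + (B₀ : ℝ) * s₀ + (-s₀) * t) (ℓ B₁ + (B₁ : ℝ) * s₁ + (-s₁) * t))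
    (ℓ B₂ + (B₂ : ℝ) * s₂ + (-s₂) * t) with hh
  have hline : ∀ (E : ℕ) (Bi : ℕ) (si : ℝ), (∀ E' ∈ f.support, E' ≠ Bi → ℓ E' + E' * si < ℓ Bi + Bi * si) →
      E ∈ f.support → ℓ E ≤ ℓ Bi + (Bi : ℝ) * si + (-si) * E := by
    intro E Bi si hsi hE
    by_cases hEB : E = Bi
    · rw [hEB]; linarith
    · have := hsi E hE hEB; linarith
  have hmaj : ∀ E ∈ f.support, ℓ E ≤ h E := fun E hE =>
    le_min (le_min (hline E B₀ s₀ hs₀ hE) (hline E B₁ s₁ hs₁ hE)) (hline E B₂ s₂ hs₂ hE)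
  have hmaj_lt : ∀ E ∈ f.support, E ≠ B₀ → E ≠ B₁ → E ≠ B₂ → ℓ E < h E := by
    intro E hE h0 h1 h2
    refine lt_min (lt_min ?_ ?_) ?_
    · have := hs₀ E hE h0; linarith
    · have := hs₁ E hE h1; linarith
    · have := hs₂ E hE h2; linarith
  have hhB0 : h B₀ = ℓ B₀ :=
    le_antisymm (((min_le_left _ _).trans (min_le_left _ _)).trans (by linarith)) (hmaj B₀ hd0.1)
  have hhB1 : h B₁ = ℓ B₁ :=
    le_antisymm (((min_le_left _ _).trans (min_le_right _ _)).trans (by linarith)) (hmaj B₁ hd1.1)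
  have hhB2 : h B₂ = ℓ B₂ := le_antisymm ((min_le_right _ _).trans (by linarith)) (hmaj B₂ hd2.1)
  have hhrev : ∀ c : Fin 5, h (d (e (Fin.revPerm c)) + d (e c) : ℕ) = ℓ (d (e (Fin.revPerm c)) + d (e c)) := by
    intro c
    rcases hrevB c with h0 | h0 | h0 <;> rw [h0]
    · exact hhB0
    · exact hhB1
    · exact hhB2
  have hrev_supp : ∀ c : Fin 5, (d (e (Fin.revPerm c)) + d (e c)) ∈ f.support := by
    intro c
    rcases hrevB c with h0 | h0 | h0 <;> rw [h0]
    · exact hd0.1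
    · exact hd1.1
    · exact hd2.1
  -- the principal Gram minor of the five letters
  set N : Matrix (Fin 5) (Fin 5) F := Matrix.of fun r c : Fin 5 =>
    M (e r) 0 0 * M (e c) 1 1 + M (e c) 0 0 * M (e r) 1 1 - M (e r) 0 1 * M (e c) 1 0 - M (e c) 0 1 * M (e r) 1 0 with hN
  have hdet : N.det = 0 :=
    det_gram_polarDet2_eq_zero (fun r => M (e r) 0 0) (fun r => M (e r) 0 1) (fun r => M (e r) 1 0) (fun r => M (e r) 1 1)
      (fun c => M (e c) 0 0) (fun c => M (e c) 0 1) (fun c => M (e c) 1 0) (fun c => M (e c) 1 1)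
  -- with `v 2 = 1` EVERY entry has the size of the corresponding coefficient
  have hentry : ∀ r c, v (N r c) = v (f.coeff (d (e r) + d (e c))) := by
    intro r c
    by_cases hrc : e r = e c
    · have hNrc : N r c = 2 * f.coeff (d (e r) + d (e c)) := by
        rw [hN, Matrix.of_apply, hrc, hf, coeff_diag_gen_of_sidon d M hsid (e c)]
        ring
      rw [hNrc, map_mul, hv2, one_mul]
    · rw [hN, Matrix.of_apply, hf, coeff_offdiag_gen_of_sidon d M hsid hrc]
  have hent : ∀ r c, N r c ≠ 0 → (d (e r) + d (e c)) ∈ f.support ∧ Real.log (v (N r c)) ≤ ℓ (d (e r) + d (e c)) := by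
    intro r c hne
    have hc : f.coeff (d (e r) + d (e c)) ≠ 0 := fun h0 =>
      (v.pos hne).ne' (by rw [hentry, h0, map_zero])
    exact ⟨Polynomial.mem_support_iff.2 hc, by rw [hentry]⟩
  -- the roof table and its weak concavity along equal sums
  set x : Fin 5 → Fin 5 → ℝ := fun c r => h ((d (e r) + d (e c) : ℕ) : ℝ) with hx
  have hconc : ∀ p₁ q₁ p₂ q₂ p₃ q₃ p₄ q₄ : Fin 5,
      (d ∘ e) p₁ + (d ∘ e) q₁ + ((d ∘ e) p₄ + (d ∘ e) q₄) = (d ∘ e) p₂ + (d ∘ e) q₂ + ((d ∘ e) p₃ + (d ∘ e) q₃) →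
      (d ∘ e) p₁ + (d ∘ e) q₁ < (d ∘ e) p₂ + (d ∘ e) q₂ → (d ∘ e) p₁ + (d ∘ e) q₁ < (d ∘ e) p₃ + (d ∘ e) q₃ →
      x p₁ q₁ + x p₄ q₄ ≤ x p₂ q₂ + x p₃ q₃ := by
    intro p₁ q₁ p₂ q₂ p₃ q₃ p₄ q₄ hsum h12 h13
    simp only [Function.comp_apply] at hsum h12 h13
    simp only [hx, hh]
    refine min3_affine_outer_le_inner _ _ _ _ _ _ _ _ _ _ ?_ ?_ ?_
    · have : d (e q₁) + d (e p₁) ≤ d (e q₂) + d (e p₂) := by omega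
      exact_mod_cast this
    · have : d (e q₁) + d (e p₁) ≤ d (e q₃) + d (e p₃) := by omega
      exact_mod_cast this
    · have : d (e q₁) + d (e p₁) + (d (e q₄) + d (e p₄)) = d (e q₂) + d (e p₂) + (d (e q₃) + d (e p₃)) := by omega
      exact_mod_cast this
  -- Leibniz terms
  have hterm : ∀ σ : Equiv.Perm (Fin 5), v (Equiv.Perm.sign σ • ∏ c, N (σ c) c) = ∏ c, v (N (σ c) c) := by
    intro σ
    rcases Int.units_eq_one_or (Equiv.Perm.sign σ) with h1 | h1
    · rw [h1, one_smul, map_prod]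
    · rw [h1, Units.neg_smul, one_smul, AbsoluteValue.map_neg, map_prod]
  have heq : ∏ c, v (N (Fin.revPerm c) c) = Real.exp (∑ c, x c (Fin.revPerm c)) := by
    rw [Real.exp_sum]
    refine Finset.prod_congr rfl fun c _ => ?_
    rw [hentry, hx]
    simp only []
    rw [hhrev c, hℓ]
    simp only []
    rw [Real.exp_log (v.pos (Polynomial.mem_support_iff.1 (hrev_supp c)))]
  have hmax : ∀ σ ∈ (univ : Finset (Equiv.Perm (Fin 5))), σ ≠ Fin.revPerm →
      v (Equiv.Perm.sign σ • ∏ c, N (σ c) c)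
        < v (Equiv.Perm.sign (Fin.revPerm : Equiv.Perm (Fin 5)) • ∏ c, N ((Fin.revPerm : Equiv.Perm (Fin 5)) c) c) := by
    intro σ _ hσ
    rw [hterm, hterm, heq]
    by_cases hz : ∃ c, N (σ c) c = 0
    · obtain ⟨c, hc⟩ := hz
      rw [Finset.prod_eq_zero (Finset.mem_univ c) (by rw [hc, map_zero])]
      exact Real.exp_pos _
    push Not at hz
    have hprod : ∏ c, v (N (σ c) c) = Real.exp (∑ c, Real.log (v (N (σ c) c))) := by
      rw [Real.exp_sum]
      exact Finset.prod_congr rfl fun c _ => (Real.exp_log (v.pos (hz c))).symm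
    rw [hprod]
    refine Real.exp_lt_exp.2 ?_
    have hle_c : ∀ c, Real.log (v (N (σ c) c)) ≤ x c (σ c) := fun c =>
      (hent _ _ (hz c)).2.trans (hmaj _ (hent _ _ (hz c)).1)
    obtain ⟨c₀, hc₀⟩ : ∃ c, σ c ≠ Fin.revPerm c := by
      by_contra hno
      push Not at hno
      exact hσ (Equiv.ext hno)
    have hne3 : d (e (σ c₀)) + d (e c₀) ≠ B₀ ∧ d (e (σ c₀)) + d (e c₀) ≠ B₁ ∧ d (e (σ c₀)) + d (e c₀) ≠ B₂ :=
      ⟨fun h0 => hc₀ (hsum_rev _ _ (Or.inl h0)), fun h0 => hc₀ (hsum_rev _ _ (Or.inr (Or.inl h0))),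
        fun h0 => hc₀ (hsum_rev _ _ (Or.inr (Or.inr h0)))⟩
    have hlt_c : Real.log (v (N (σ c₀) c₀)) < x c₀ (σ c₀) :=
      (hent _ _ (hz c₀)).2.trans_lt (hmaj_lt _ (hent _ _ (hz c₀)).1 hne3.1 hne3.2.1 hne3.2.2)
    calc ∑ c, Real.log (v (N (σ c) c)) < ∑ c, x c (σ c) :=
          Finset.sum_lt_sum (fun c _ => hle_c c) ⟨c₀, Finset.mem_univ _, hlt_c⟩
      _ ≤ ∑ c, x c (Fin.revPerm c) := sum_perm_le_sum_rev x (d ∘ e) (d ∘ e) hmono hmono hconc _ σ le_rfl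
  have hsum := abv_sum_eq_of_unique_max v hv (univ : Finset (Equiv.Perm (Fin 5)))
    (fun σ => Equiv.Perm.sign σ • ∏ c, N (σ c) c) (Finset.mem_univ (Fin.revPerm : Equiv.Perm (Fin 5))) hmax
  rw [← Matrix.det_apply, hdet, map_zero, hterm, heq] at hsum
  exact absurd hsum (ne_of_lt (Real.exp_pos _))

/-! ## §2 The two-obstruction count -/

/-- a chain of pairs (product order) has injective index sum. [bookkeeping] -/
theorem sum_injOn_of_pairChain {K : ℕ} (D : Finset (Fin K × Fin K))
    (hchain : ∀ p ∈ D, ∀ p' ∈ D, p.1 < p'.1 → p.2 ≤ p'.2) :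
    Set.InjOn (fun p : Fin K × Fin K => p.1.val + p.2.val) (D : Set (Fin K × Fin K)) := by
  intro p hp p' hp' heq
  simp only [] at heq
  rcases lt_trichotomy p.1 p'.1 with h | h | h
  · have h2 : p.2 ≤ p'.2 := hchain p hp p' hp' h
    have h1 : p.1.val < p'.1.val := h
    have h2' : p.2.val ≤ p'.2.val := h2
    omega
  · have h2 : p.2.val = p'.2.val := by have := congrArg Fin.val h; omega
    exact Prod.ext h (Fin.ext h2)
  · have h2 : p'.2 ≤ p.2 := hchain p' hp' p hp h
    have h1 : p'.1.val < p.1.val := h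
    have h2' : p'.2.val ≤ p.2.val := h2
    omega

/-- **THE TWO-OBSTRUCTION COUNT:** pairs `i < j` with no three pairwise nested members, plus letters `b` not strictly inside the inner pair
of two nested members, number at most `(2K − 1) + (2K − 5)` (`= 4K − 6` for `K ≥ 3`; located-sharp).  Two-copy injection: minimal pairs
by `i + j` and the «free» letters by `2b` into `[0, 2K − 2]`, non-minimal pairs and the remaining letters into `[2, 2K − 4]`. [elementary] -/
theorem card_pairs_add_diag_le {K : ℕ} (P : Finset (Fin K × Fin K)) (Q : Finset (Fin K)) (hlt : ∀ p ∈ P, p.1 < p.2)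
    (hno3 : ∀ p ∈ P, ∀ p' ∈ P, ∀ q ∈ P, ¬ (p.1 < p'.1 ∧ p'.1 < q.1 ∧ q.2 < p'.2 ∧ p'.2 < p.2))
    (hQ : ∀ b ∈ Q, ∀ p ∈ P, ∀ q ∈ P, ¬ (p.1 < q.1 ∧ q.1 < b ∧ b < q.2 ∧ q.2 < p.2)) :
    P.card + Q.card ≤ (2 * K - 1) + (2 * K - 5) := by
  -- minimal / non-minimal pairs
  set P₁ := P.filter fun p => ¬ ∃ q ∈ P, p.1 < q.1 ∧ q.2 < p.2 with hP₁
  set P₂ := P.filter fun p => ∃ q ∈ P, p.1 < q.1 ∧ q.2 < p.2 with hP₂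
  have hsplitP : P₂.card + P₁.card = P.card := Finset.card_filter_add_card_filter_not (s := P) _
  -- letters whose doubled index is free among the minimal sums / the rest
  set Q₁ := Q.filter fun b => ¬ ∃ q ∈ P₁, q.1.val + q.2.val = 2 * b.val with hQ₁
  set Q₂ := Q.filter fun b => ∃ q ∈ P₁, q.1.val + q.2.val = 2 * b.val with hQ₂
  have hsplitQ : Q₂.card + Q₁.card = Q.card := Finset.card_filter_add_card_filter_not (s := Q) _
  -- both families of pairs are chains
  have hchain₁ : ∀ p ∈ P₁, ∀ p' ∈ P₁, p.1 < p'.1 → p.2 ≤ p'.2 := by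
    intro p hp p' hp' h1
    by_contra h2
    push Not at h2
    exact (Finset.mem_filter.1 hp).2 ⟨p', (Finset.mem_filter.1 hp').1, h1, h2⟩
  have hchain₂ : ∀ p ∈ P₂, ∀ p' ∈ P₂, p.1 < p'.1 → p.2 ≤ p'.2 := by
    intro p hp p' hp' h1
    by_contra h2
    push Not at h2
    obtain ⟨hpP, -⟩ := Finset.mem_filter.1 hp
    obtain ⟨hp'P, q, hqP, hq1, hq2⟩ := Finset.mem_filter.1 hp'
    exact hno3 p hpP p' hp'P q hqP ⟨h1, hq1, hq2, h2⟩
  have hinj₁ := sum_injOn_of_pairChain P₁ hchain₁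
  have hinj₂ := sum_injOn_of_pairChain P₂ hchain₂
  have hinjQ : Function.Injective (fun b : Fin K => 2 * b.val) := by
    intro a b h
    simp only [] at h
    exact Fin.ext (by omega)
  -- copy 1: minimal sums and free doubled letters inside `[0, 2K − 2]`
  set S₁ : Finset ℕ := P₁.image (fun p : Fin K × Fin K => p.1.val + p.2.val) ∪ Q₁.image (fun b : Fin K => 2 * b.val) with hS₁
  have hS₁card : S₁.card = P₁.card + Q₁.card := by
    rw [hS₁, Finset.card_union_of_disjoint, Finset.card_image_of_injOn hinj₁, Finset.card_image_of_injective _ hinjQ]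
    rw [Finset.disjoint_left]
    intro s hs1 hs2
    obtain ⟨q, hq, rfl⟩ := Finset.mem_image.1 hs1
    obtain ⟨b, hb, hbq⟩ := Finset.mem_image.1 hs2
    exact (Finset.mem_filter.1 hb).2 ⟨q, hq, hbq.symm⟩
  have hS₁sub : S₁ ⊆ Finset.range (2 * K - 1) := by
    intro s hs
    rw [Finset.mem_range]
    rcases Finset.mem_union.1 hs with hs | hs
    · obtain ⟨q, hq, rfl⟩ := Finset.mem_image.1 hs
      have h1 := hlt q (Finset.mem_filter.1 hq).1
      have h2 := q.2.isLt
      have h1' : q.1.val < q.2.val := h1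
      omega
    · obtain ⟨b, -, rfl⟩ := Finset.mem_image.1 hs
      have := b.isLt
      omega
  -- copy 2: non-minimal sums and the remaining doubled letters inside `[2, 2K − 4]`
  set S₂ : Finset ℕ := P₂.image (fun p : Fin K × Fin K => p.1.val + p.2.val) ∪ Q₂.image (fun b : Fin K => 2 * b.val) with hS₂
  have hS₂card : S₂.card = P₂.card + Q₂.card := by
    rw [hS₂, Finset.card_union_of_disjoint, Finset.card_image_of_injOn hinj₂, Finset.card_image_of_injective _ hinjQ]
    rw [Finset.disjoint_left]
    intro s hs1 hs2
    obtain ⟨p, hp, rfl⟩ := Finset.mem_image.1 hs1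
    obtain ⟨b, hb, hbp⟩ := Finset.mem_image.1 hs2
    obtain ⟨hbQ, q, hq, hbq⟩ := Finset.mem_filter.1 hb
    obtain ⟨hpP, -⟩ := Finset.mem_filter.1 hp
    obtain ⟨hqP, hqmin⟩ := Finset.mem_filter.1 hq
    -- `p = (b − s, b + s)`, `q = (b − r, b + r)`: either `p ⊋ q ∋ b` (then `b ∉ Q`) or `q ⊋ p` (then `q` is not minimal)
    have hp12 : p.1.val < p.2.val := hlt p hpP
    have hq12 : q.1.val < q.2.val := hlt q hqP
    have hpq : p ≠ q := by
      rintro rfl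
      exact (Finset.mem_filter.1 hp).2.elim fun q' hq' => hqmin ⟨q', hq'⟩
    rcases lt_trichotomy p.1.val q.1.val with h1 | h1 | h1
    · -- p strictly contains q, and b is strictly inside q
      have hb1 : q.1.val < b.val := by omega
      have hb2 : b.val < q.2.val := by omega
      have hq2 : q.2.val < p.2.val := by omega
      exact hQ b hbQ p hpP q hqP ⟨h1, hb1, hb2, hq2⟩
    · have h2 : p.2.val = q.2.val := by omega
      exact hpq (Prod.ext (Fin.ext h1) (Fin.ext h2))
    · -- q strictly contains p: contradicts minimality of q
      have hp2 : p.2.val < q.2.val := by omega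
      exact hqmin ⟨p, hpP, h1, hp2⟩
  have hS₂sub : S₂ ⊆ Finset.Icc 2 (2 * K - 4) := by
    intro s hs
    rw [Finset.mem_Icc]
    rcases Finset.mem_union.1 hs with hs | hs
    · obtain ⟨p, hp, rfl⟩ := Finset.mem_image.1 hs
      obtain ⟨hpP, q, hqP, hq1, hq2⟩ := Finset.mem_filter.1 hp
      have h1 : p.1.val < q.1.val := hq1
      have h2 : q.2.val < p.2.val := hq2
      have h3 : q.1.val < q.2.val := hlt q hqP
      have h4 := p.2.isLt
      omega
    · obtain ⟨b, hb, rfl⟩ := Finset.mem_image.1 hs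
      obtain ⟨-, q, hq, hbq⟩ := Finset.mem_filter.1 hb
      have h1 : q.1.val < q.2.val := hlt q (Finset.mem_filter.1 hq).1
      have h2 := q.2.isLt
      omega
  have h1 := Finset.card_le_card hS₁sub
  have h2 := Finset.card_le_card hS₂sub
  rw [hS₁card, Finset.card_range] at h1
  rw [hS₂card, Nat.card_Icc] at h2
  omega

end Summit.ValiantsHypothesis.ValiantsHypothesis.Theorems.KPlusLogSqLaw.ValDoor
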